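import Literature.MathematicalPhysics.QuantumLattice.QuantumRotorGroundStateProofs
import Literature.MathematicalPhysics.QuantumLattice.QuantumRotorTruncated
import Mathlib.MeasureTheory.Integral.Pi
import Mathlib.MeasureTheory.Constructions.Pi
import Mathlib.Analysis.SpecialFunctions.Integrals.Basic
import Mathlib.Analysis.SpecialFunctions.ExpDeriv
import Mathlib.MeasureTheory.Integral.Bochner.Set
import HarnessLib

/-!
# Quantum rotators: trigonometric polynomials as trial states (the Galerkin bridge)

Sibling file of `QuantumRotorGroundState.lean` (item
`provefact-Literature.MathematicalPhysics.QuantumLa-0bccfc6de5`, the named fact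
`QuantumRotor.KleinPerez1992_rotorGroundStateLRO`). No statement is touched. This file identifies
the variational vocabulary of `QuantumRotorGroundState.lean` (trial states `Ψ`, the energy form
`QuantumRotor.energy`, the correlation `QuantumRotor.cosCorrelation` on the cell `[-π, π)^Λ`) on
**trigonometric polynomials of degree `≤ M`** with the Galerkin matrices of
`QuantumRotorTruncated.lean`:

* the Fourier monomials `e_n(φ) = exp(i Σ_x n_x φ_x)` (`fourierFn`), their orthogonality on the
  cell (`integral_fourierFn_angleCell`: `∫_{[-π,π)^Λ} e_n = (2π)^{|Λ|} δ_{n,0}`, by Fubini over the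
  coordinates and the one-dimensional `∫_{-π}^{π} e^{ikt} dt = 2π δ_{k,0}`);
* trigonometric polynomials `Σ_σ c_σ e_{n(σ)}` indexed by the tensor indices
  `σ : Λ → Fin (2M+1)` of the Galerkin space (`trigPoly`, `n(σ)_x = σ_x - M`), their products with a
  monomial integrated over the cell (`integral_fourierFn_mul_trigPoly_mul_conj`), Parseval
  (`integral_norm_sq_trigPoly`);
* the normalised trigonometric polynomial of a unit coefficient vector as a `TrialState`
  (`trialOf`), and the two bridge identities:
  `cosCorrelation (trialOf c) x y = Re ⟨c, (cos_x cos_y + sin_x sin_y) c⟩` for `x ≠ y`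
  (`cosCorrelation_trialOf`; `≥` for `x = y`), and
  `energy h J nn (trialOf c) = Re ⟨c, H_M c⟩ + (J/2) Σ_x #{y ∼ x}` (`energy_trialOf`) — the
  energy form of a trigonometric polynomial IS the Galerkin matrix `truncHamiltonian` (shifted
  by the constant making the form non-negative);
* zero-padding of coefficient vectors `M ≤ M'` (`padCoeff`), which does not change the
  polynomial, whence `E₀(H_{M'}) ≤ E₀(H_M)`-type monotonicity downstream.

## References

* A. Klein, J. F. Perez, Commun. Math. Phys. 147 (1992) 241–252, §2 (2.1), (2.3), §3 (the momentum
  basis `e^{inφ}`) [KleinPerez1992].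
* J. Wojtkiewicz, W. Pusz, P. Stachura, Rep. Math. Phys. 77 (2016) 183–209, §3.1
  [WojtkiewiczPuszStachura2016].
-/

noncomputable section

open MeasureTheory Matrix Complex Finset Set
open scoped ENNReal NNReal ComplexConjugate ComplexOrder

namespace Literature.MathematicalPhysics.QuantumLattice

namespace QuantumRotor

variable {Λ : Type} [Fintype Λ]

/-! ### Fourier monomials on `ℝ^Λ` -/

/-- The Fourier monomial `e_n(φ) = exp(i Σ_x n_x φ_x)` of integer frequencies `n : Λ → ℤ`.
[cite: KleinPerez1992, §3 (the basis e^{inφ})] -/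
def fourierFn (n : Λ → ℤ) (φ : Λ → ℝ) : ℂ :=
  Complex.exp ((∑ x, (n x : ℝ) * φ x : ℝ) * I)

/-- The monomial is the product of the one-dimensional characters. [folklore] -/
theorem fourierFn_eq_prod (n : Λ → ℤ) (φ : Λ → ℝ) :
    fourierFn n φ = ∏ x, Complex.exp ((((n x : ℝ) * φ x : ℝ) : ℂ) * I) := by
  rw [fourierFn, Complex.ofReal_sum, sum_mul, Complex.exp_sum]

/-- `|e_n| = 1`. [folklore] -/
theorem norm_fourierFn (n : Λ → ℤ) (φ : Λ → ℝ) : ‖fourierFn n φ‖ = 1 :=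
  Complex.norm_exp_ofReal_mul_I _

/-- `e_0 = 1`. [folklore] -/
@[simp] theorem fourierFn_zero (φ : Λ → ℝ) : fourierFn (0 : Λ → ℤ) φ = 1 := by
  simp [fourierFn]

/-- `e_{n+m} = e_n e_m`. [folklore] -/
theorem fourierFn_add (n m : Λ → ℤ) (φ : Λ → ℝ) :
    fourierFn (n + m) φ = fourierFn n φ * fourierFn m φ := by
  rw [fourierFn, fourierFn, fourierFn, ← Complex.exp_add, ← add_mul, ← Complex.ofReal_add,
    ← sum_add_distrib]
  congr 3
  refine sum_congr rfl fun x _ => ?_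
  simp only [Pi.add_apply, Int.cast_add]
  ring

/-- `conj e_n = e_{-n}`. [folklore] -/
theorem conj_fourierFn (n : Λ → ℤ) (φ : Λ → ℝ) : conj (fourierFn n φ) = fourierFn (-n) φ := by
  rw [fourierFn, fourierFn, ← Complex.exp_conj, map_mul, Complex.conj_ofReal, Complex.conj_I,
    mul_neg, ← neg_mul, ← Complex.ofReal_neg, ← sum_neg_distrib]
  congr 3
  refine sum_congr rfl fun x _ => ?_
  simp only [Pi.neg_apply, Int.cast_neg, neg_mul]

/-- `e_n conj(e_m) = e_{n-m}`. [folklore] -/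
theorem fourierFn_mul_conj (n m : Λ → ℤ) (φ : Λ → ℝ) :
    fourierFn n φ * conj (fourierFn m φ) = fourierFn (n - m) φ := by
  rw [conj_fourierFn, ← fourierFn_add, sub_eq_add_neg]

/-- `e_n` is `2π`-periodic in every angle. [folklore] -/
theorem fourierFn_periodic [DecidableEq Λ] (n : Λ → ℤ) (φ : Λ → ℝ) (x : Λ) :
    fourierFn n (φ + Pi.single x (2 * Real.pi)) = fourierFn n φ := by
  rw [fourierFn, fourierFn]
  have hs : ∑ y, (n y : ℝ) * ((φ + Pi.single x (2 * Real.pi) : Λ → ℝ) y) =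
      ∑ y, (n y : ℝ) * φ y + n x * (2 * Real.pi) := by
    simp only [Pi.add_apply, mul_add, sum_add_distrib, Pi.single_apply, mul_ite, mul_zero,
      Finset.sum_ite_eq', Finset.mem_univ, if_true]
  rw [hs, Complex.ofReal_add, add_mul, Complex.exp_add]
  have h1 : Complex.exp (((n x * (2 * Real.pi) : ℝ) : ℂ) * I) = 1 := by
    have := Complex.exp_int_mul_two_pi_mul_I (n x)
    rw [← this]
    congr 1
    push_cast
    ring
  rw [h1, mul_one]

/-- The real-linear phase `φ ↦ Σ_x n_x φ_x` as a continuous linear map into `ℂ`. [folklore] -/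
def phaseCLM (n : Λ → ℤ) : (Λ → ℝ) →L[ℝ] ℂ :=
  Complex.ofRealCLM.comp (∑ x, (n x : ℝ) • ContinuousLinearMap.proj x)

/-- Unfolding `phaseCLM`. [folklore] -/
theorem phaseCLM_apply (n : Λ → ℤ) (φ : Λ → ℝ) :
    phaseCLM n φ = ((∑ x, (n x : ℝ) * φ x : ℝ) : ℂ) := by
  simp [phaseCLM]

/-- `e_n = exp ∘ (I • phase)`. [folklore] -/
theorem fourierFn_eq_exp_phaseCLM (n : Λ → ℤ) (φ : Λ → ℝ) :
    fourierFn n φ = Complex.exp ((I • phaseCLM n) φ) := by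
  rw [fourierFn, FunLike.coe_smul, Pi.smul_apply, phaseCLM_apply, smul_eq_mul, mul_comm]

/-- **The derivative of a monomial**: `D e_n(φ) = e_n(φ) · i Σ_x n_x dφ_x`. [folklore] -/
theorem hasFDerivAt_fourierFn (n : Λ → ℤ) (φ : Λ → ℝ) :
    HasFDerivAt (fourierFn n) (fourierFn n φ • (I • phaseCLM n)) φ := by
  have h := ((I • phaseCLM n).hasFDerivAt (x := φ)).cexp
  simp only [← fourierFn_eq_exp_phaseCLM] at h
  convert h using 2

/-- `∂_x e_n = i n_x e_n`. [folklore] -/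
theorem fderiv_fourierFn_single [DecidableEq Λ] (n : Λ → ℤ) (φ : Λ → ℝ) (x : Λ) :
    fderiv ℝ (fourierFn n) φ (Pi.single x 1) = I * (n x : ℂ) * fourierFn n φ := by
  rw [(hasFDerivAt_fourierFn n φ).fderiv, FunLike.coe_smul, Pi.smul_apply,
    FunLike.coe_smul, Pi.smul_apply, phaseCLM_apply]
  have hs : ∑ y, (n y : ℝ) * (Pi.single x (1 : ℝ) : Λ → ℝ) y = n x := by
    simp only [Pi.single_apply, mul_ite, mul_one, mul_zero, Finset.sum_ite_eq', Finset.mem_univ,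
      if_true]
  rw [hs, smul_eq_mul, smul_eq_mul]
  push_cast
  ring

/-- `e_n` is smooth. [folklore] -/
theorem contDiff_fourierFn (n : Λ → ℤ) {k : WithTop ℕ∞} : ContDiff ℝ k (fourierFn n) := by
  have : (fourierFn n : (Λ → ℝ) → ℂ) = fun φ => Complex.exp ((I • phaseCLM n) φ) :=
    funext (fourierFn_eq_exp_phaseCLM n)
  rw [this]
  exact Complex.contDiff_exp.comp (I • phaseCLM n).contDiff

/-- `e_n` is continuous. [folklore] -/
theorem continuous_fourierFn (n : Λ → ℤ) : Continuous (fourierFn n) :=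
  (contDiff_fourierFn n (k := 0)).continuous

/-! ### Orthogonality on the cell `[-π, π)^Λ` -/

/-- One angle: `∫_{-π}^{π} e^{ikt} dt = 2π δ_{k,0}`. [folklore] -/
theorem integral_exp_int_mul_Ico (k : ℤ) :
    ∫ t in Set.Ico (-Real.pi) Real.pi, Complex.exp ((((k : ℝ) * t : ℝ) : ℂ) * I) =
      if k = 0 then ((2 * Real.pi : ℝ) : ℂ) else 0 := by
  rw [integral_Ico_eq_integral_Ioc, ← intervalIntegral.integral_of_le (by linarith [Real.pi_pos])]
  split_ifs with hk
  · subst hk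
    simp only [Int.cast_zero, zero_mul, Complex.ofReal_zero, Complex.exp_zero,
      intervalIntegral.integral_const, Complex.real_smul, mul_one]
    push_cast
    ring
  · have hc : (k : ℂ) * I ≠ 0 := mul_ne_zero (by exact_mod_cast hk) Complex.I_ne_zero
    have h1 : (fun t : ℝ => Complex.exp ((((k : ℝ) * t : ℝ) : ℂ) * I)) =
        fun t : ℝ => Complex.exp ((k : ℂ) * I * t) := by
      funext t
      congr 1
      push_cast
      ring
    rw [h1, integral_exp_mul_complex hc]
    have h2 : Complex.exp ((k : ℂ) * I * (Real.pi : ℝ)) = Complex.exp ((k : ℂ) * I * (-Real.pi : ℝ)) := by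
      rw [show (k : ℂ) * I * (Real.pi : ℝ) = (k : ℂ) * I * (-Real.pi : ℝ) + k * (2 * Real.pi * I) by
        push_cast; ring, Complex.exp_add, Complex.exp_int_mul_two_pi_mul_I, mul_one]
    rw [h2, sub_self, zero_div]

/-- **Orthogonality of the monomials on the cell**: `∫_{[-π,π)^Λ} e_n = (2π)^{|Λ|} δ_{n,0}`
(Fubini over the coordinates). [cite: KleinPerez1992, §3] -/
theorem integral_fourierFn_angleCell [DecidableEq Λ] (n : Λ → ℤ) :
    ∫ φ in angleCell Λ, fourierFn n φ =
      if n = 0 then (((2 * Real.pi) ^ Fintype.card Λ : ℝ) : ℂ) else 0 := by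
  rw [angleCell_eq_pi, volume_pi, Measure.restrict_pi_pi]
  simp_rw [fourierFn_eq_prod]
  rw [integral_fintype_prod_eq_prod (𝕜 := ℂ)
    (f := fun x (t : ℝ) => Complex.exp ((((n x : ℝ) * t : ℝ) : ℂ) * I))]
  simp_rw [integral_exp_int_mul_Ico]
  split_ifs with hn
  · subst hn
    simp only [Pi.zero_apply, if_true, prod_const, card_univ]
    push_cast
    ring
  · obtain ⟨x, hx⟩ : ∃ x, n x ≠ 0 := by
      by_contra h
      push Not at h
      exact hn (funext h)
    exact prod_eq_zero (Finset.mem_univ x) (if_neg hx)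

/-- Continuous functions are integrable on the cell (bounded on the compact cube `[-π, π]^Λ`,
which contains the cell). [folklore] -/
theorem integrableOn_angleCell_of_continuous {f : (Λ → ℝ) → ℂ} (hf : Continuous f) :
    IntegrableOn f (angleCell Λ) :=
  (hf.continuousOn.integrableOn_compact (isCompact_univ_pi fun _ : Λ => isCompact_Icc)).mono_set
    angleCell_subset_Icc

/-! ### Trigonometric polynomials indexed by the Galerkin tensor indices -/

section TrigPoly

variable [DecidableEq Λ] (M : ℕ)

/-- The frequency vector `n(σ)_x = σ_x - M ∈ {-M, …, M}` of a tensor index `σ : Λ → Fin (2M+1)`.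
[folklore] -/
def momVec (σ : TensorIndex Λ (2 * M + 1)) : Λ → ℤ := fun x => ((σ x : ℕ) : ℤ) - M

omit [Fintype Λ] [DecidableEq Λ] in
/-- Unfolding `momVec`. [folklore] -/
theorem momVec_apply (σ : TensorIndex Λ (2 * M + 1)) (x : Λ) : momVec M σ x = ((σ x : ℕ) : ℤ) - M :=
  rfl

omit [Fintype Λ] [DecidableEq Λ] in
/-- `σ ↦ n(σ)` is injective. [folklore] -/
theorem momVec_injective : Function.Injective (momVec (Λ := Λ) M) := by
  intro σ τ h
  funext x
  have hx := congrFun h x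
  rw [momVec_apply, momVec_apply, sub_left_inj, Int.natCast_inj] at hx
  exact Fin.ext hx

/-- The trigonometric polynomial `Σ_σ c_σ e_{n(σ)}` with coefficient vector `c` on the Galerkin
indices. [cite: KleinPerez1992, §3] -/
def trigPoly (c : TensorIndex Λ (2 * M + 1) → ℂ) (φ : Λ → ℝ) : ℂ :=
  ∑ σ, c σ * fourierFn (momVec M σ) φ

/-- Trigonometric polynomials are smooth. [folklore] -/
theorem contDiff_trigPoly (c : TensorIndex Λ (2 * M + 1) → ℂ) {k : WithTop ℕ∞} :
    ContDiff ℝ k (trigPoly M c) := by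
  unfold trigPoly
  exact ContDiff.sum fun σ _ => contDiff_const.mul (contDiff_fourierFn _)

/-- Trigonometric polynomials are continuous. [folklore] -/
theorem continuous_trigPoly (c : TensorIndex Λ (2 * M + 1) → ℂ) : Continuous (trigPoly M c) :=
  (contDiff_trigPoly M c (k := 0)).continuous

/-- Trigonometric polynomials are `2π`-periodic in every angle. [folklore] -/
theorem trigPoly_periodic (c : TensorIndex Λ (2 * M + 1) → ℂ) (φ : Λ → ℝ) (x : Λ) :
    trigPoly M c (φ + Pi.single x (2 * Real.pi)) = trigPoly M c φ := by
  unfold trigPoly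
  exact sum_congr rfl fun σ _ => by rw [fourierFn_periodic]

/-- **The angular derivative of a trigonometric polynomial is the trigonometric polynomial of the
momentum-multiplied coefficients**: `∂_x Σ c_σ e_{n(σ)} = Σ (i n(σ)_x c_σ) e_{n(σ)}`. [folklore] -/
theorem fderiv_trigPoly_single (c : TensorIndex Λ (2 * M + 1) → ℂ) (φ : Λ → ℝ) (x : Λ) :
    fderiv ℝ (trigPoly M c) φ (Pi.single x 1) =
      trigPoly M (fun σ => I * (momVec M σ x : ℂ) * c σ) φ := by
  have h : HasFDerivAt (trigPoly M c)
      (∑ σ, c σ • (fourierFn (momVec M σ) φ • (I • phaseCLM (momVec M σ)))) φ := by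
    unfold trigPoly
    exact HasFDerivAt.fun_sum fun σ _ => (hasFDerivAt_fourierFn _ φ).const_mul (c σ)
  rw [h.fderiv, FunLike.coe_sum, Finset.sum_apply, trigPoly]
  refine sum_congr rfl fun σ _ => ?_
  have h1 := fderiv_fourierFn_single (momVec M σ) φ x
  rw [(hasFDerivAt_fourierFn (momVec M σ) φ).fderiv] at h1
  rw [FunLike.coe_smul, Pi.smul_apply, h1, smul_eq_mul]
  ring

/-- **A monomial times a trigonometric polynomial times a conjugate one, integrated over the cell**:
`∫ e_m · P_c · conj(P_{c'}) = (2π)^{|Λ|} Σ_{σ,τ : n(σ) + m = n(τ)} c_σ conj(c'_τ)`.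
[cite: KleinPerez1992, §3] -/
theorem integral_fourierFn_mul_trigPoly_mul_conj (m : Λ → ℤ) (c c' : TensorIndex Λ (2 * M + 1) → ℂ) :
    ∫ φ in angleCell Λ, fourierFn m φ * (trigPoly M c φ * conj (trigPoly M c' φ)) =
      (((2 * Real.pi) ^ Fintype.card Λ : ℝ) : ℂ) *
        ∑ σ, ∑ τ, (if momVec M σ + m = momVec M τ then c σ * conj (c' τ) else 0) := by
  have hpt : ∀ φ : Λ → ℝ, fourierFn m φ * (trigPoly M c φ * conj (trigPoly M c' φ)) =
      ∑ σ, ∑ τ, c σ * conj (c' τ) * fourierFn (momVec M σ + m - momVec M τ) φ := by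
    intro φ
    rw [trigPoly, trigPoly, map_sum, sum_mul_sum, mul_sum]
    refine sum_congr rfl fun σ _ => ?_
    rw [mul_sum]
    refine sum_congr rfl fun τ _ => ?_
    rw [map_mul, ← fourierFn_mul_conj, fourierFn_add]
    ring
  simp_rw [hpt]
  have hint : ∀ (a : ℂ) (k : Λ → ℤ), IntegrableOn (fun φ => a * fourierFn k φ) (angleCell Λ) :=
    fun a k => integrableOn_angleCell_of_continuous (continuous_const.mul (continuous_fourierFn k))
  rw [integral_finsetSum _ (fun σ _ => integrable_finsetSum _ fun τ _ => hint _ _)]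
  rw [mul_sum]
  refine sum_congr rfl fun σ _ => ?_
  rw [integral_finsetSum _ (fun τ _ => hint _ _), mul_sum]
  refine sum_congr rfl fun τ _ => ?_
  rw [integral_const_mul, integral_fourierFn_angleCell]
  by_cases hst : momVec M σ + m = momVec M τ
  · rw [if_pos (sub_eq_zero.2 hst), if_pos hst, mul_comm]
  · rw [if_neg (fun h => hst (sub_eq_zero.1 h)), if_neg hst, mul_zero, mul_zero]

/-- **Parseval on the cell**: `∫ P_c conj(P_{c'}) = (2π)^{|Λ|} Σ_σ c_σ conj(c'_σ)`.
[cite: KleinPerez1992, §3] -/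
theorem integral_trigPoly_mul_conj (c c' : TensorIndex Λ (2 * M + 1) → ℂ) :
    ∫ φ in angleCell Λ, trigPoly M c φ * conj (trigPoly M c' φ) =
      (((2 * Real.pi) ^ Fintype.card Λ : ℝ) : ℂ) * ∑ σ, c σ * conj (c' σ) := by
  have h := integral_fourierFn_mul_trigPoly_mul_conj M 0 c c'
  simp only [fourierFn_zero, one_mul, add_zero] at h
  rw [h]
  congr 1
  refine sum_congr rfl fun σ _ => ?_
  rw [Finset.sum_eq_single σ (fun τ _ hτ => if_neg (fun h' => hτ (momVec_injective M h').symm))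
    (fun h' => absurd (Finset.mem_univ σ) h'), if_pos rfl]

/-- Parseval, norm form: `∫ |P_c|² = (2π)^{|Λ|} Σ_σ |c_σ|²`. [cite: KleinPerez1992, §3] -/
theorem integral_norm_sq_trigPoly (c : TensorIndex Λ (2 * M + 1) → ℂ) :
    ∫ φ in angleCell Λ, ‖trigPoly M c φ‖ ^ 2 = (2 * Real.pi) ^ Fintype.card Λ * ∑ σ, ‖c σ‖ ^ 2 := by
  apply Complex.ofReal_injective
  rw [← integral_complex_ofReal]
  push_cast
  have h := integral_trigPoly_mul_conj M c c
  simp_rw [Complex.mul_conj, Complex.normSq_eq_norm_sq] at h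
  push_cast at h
  exact h

end TrigPoly

/-! ### The hopping `e^{i(φ_x - φ_y)}` and the matrix `U_x U_yᵀ` -/

section Hopping

variable [DecidableEq Λ] (M : ℕ)

omit [Fintype Λ] in
/-- The frequency shift `n(σ) + eₓ - e_y = n(τ)` in coordinates. [folklore] -/
theorem momVec_add_shift_eq_iff {x y : Λ} (hxy : x ≠ y) (σ τ : TensorIndex Λ (2 * M + 1)) :
    momVec M σ + (Pi.single x 1 - Pi.single y 1) = momVec M τ ↔
      (τ x).val = (σ x).val + 1 ∧ (σ y).val = (τ y).val + 1 ∧ ∀ z, z ≠ x → z ≠ y → τ z = σ z := by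
  constructor
  · intro h
    have hz : ∀ z, ((σ z : ℕ) : ℤ) + ((Pi.single x (1 : ℤ) : Λ → ℤ) z - (Pi.single y (1 : ℤ) : Λ → ℤ) z) =
        ((τ z : ℕ) : ℤ) := by
      intro z
      have := congrFun h z
      simp only [Pi.add_apply, Pi.sub_apply, momVec_apply] at this
      linarith
    refine ⟨?_, ?_, ?_⟩
    · have h1 := hz x
      rw [Pi.single_eq_same, Pi.single_eq_of_ne hxy] at h1
      omega
    · have h1 := hz y
      rw [Pi.single_eq_same, Pi.single_eq_of_ne (Ne.symm hxy)] at h1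
      omega
    · intro z hzx hzy
      have h1 := hz z
      rw [Pi.single_eq_of_ne hzx, Pi.single_eq_of_ne hzy] at h1
      exact Fin.ext (by omega)
  · rintro ⟨h1, h2, h3⟩
    funext z
    simp only [Pi.add_apply, Pi.sub_apply, momVec_apply]
    by_cases hzx : z = x
    · subst hzx
      rw [Pi.single_eq_same, Pi.single_eq_of_ne hxy]
      omega
    · by_cases hzy : z = y
      · subst hzy
        rw [Pi.single_eq_same, Pi.single_eq_of_ne hzx]
        omega
      · rw [Pi.single_eq_of_ne hzx, Pi.single_eq_of_ne hzy, h3 z hzx hzy]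
        omega

/-- **The matrix of the compressed hopping**: for `x ≠ y`, `(U_x U_yᵀ)_{τσ} = 1` iff
`n(σ) + eₓ - e_y = n(τ)`, else `0`. [folklore] -/
theorem siteRaise_mul_siteLower_apply {x y : Λ} (hxy : x ≠ y) (τ σ : TensorIndex Λ (2 * M + 1)) :
    (siteRaise M x * siteLower M y) τ σ =
      if momVec M σ + (Pi.single x 1 - Pi.single y 1) = momVec M τ then 1 else 0 := by
  set ρ₀ : TensorIndex Λ (2 * M + 1) := Function.update τ x (σ x) with hρ₀
  rw [Matrix.mul_apply, Finset.sum_eq_single ρ₀]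
  · -- the main term
    rw [siteRaise, siteLower, onSite_apply, onSite_apply,
      if_pos (fun z hz => by rw [hρ₀, Function.update_of_ne hz])]
    have hρx : ρ₀ x = σ x := by rw [hρ₀, Function.update_self]
    have hρy : ρ₀ y = τ y := by rw [hρ₀, Function.update_of_ne (Ne.symm hxy)]
    have hcond : (∀ z, z ≠ y → ρ₀ z = σ z) ↔ ∀ z, z ≠ x → z ≠ y → τ z = σ z := by
      constructor
      · intro h z hzx hzy
        rw [← h z hzy, hρ₀, Function.update_of_ne hzx]
      · intro h z hzy
        by_cases hzx : z = x
        · subst hzx; exact hρx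
        · rw [hρ₀, Function.update_of_ne hzx, h z hzx hzy]
    rw [if_congr hcond rfl rfl, hρx, hρy, truncRaise_apply, truncRaise_transpose_apply,
      if_congr (momVec_add_shift_eq_iff M hxy σ τ) rfl rfl]
    by_cases h1 : (τ x).val = (σ x).val + 1 <;> by_cases h3 : ∀ z, z ≠ x → z ≠ y → τ z = σ z <;>
      by_cases h2 : (σ y).val = (τ y).val + 1 <;> simp [h1, h2, h3]
  · -- all other `ρ` contribute zero
    intro ρ _ hρ
    rw [siteRaise, siteLower, onSite_apply, onSite_apply]
    by_cases hA : ∀ z, z ≠ x → τ z = ρ z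
    · have hρx : ρ x ≠ σ x := by
        intro h
        apply hρ
        funext z
        by_cases hzx : z = x
        · subst hzx; rw [h, hρ₀, Function.update_self]
        · rw [hρ₀, Function.update_of_ne hzx, hA z hzx]
      rw [if_pos hA, if_neg (fun h => hρx (h x hxy)), mul_zero]
    · rw [if_neg hA, zero_mul]
  · exact fun h => absurd (Finset.mem_univ _) h

/-- `⟨c', U_x U_yᵀ c⟩ = Σ_{σ,τ : n(σ)+eₓ-e_y = n(τ)} c_σ conj(c'_τ)` for `x ≠ y`. [folklore] -/
theorem star_dotProduct_hopping_mulVec {x y : Λ} (hxy : x ≠ y) (c c' : TensorIndex Λ (2 * M + 1) → ℂ) :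
    star c' ⬝ᵥ ((siteRaise M x * siteLower M y) *ᵥ c) =
      ∑ σ, ∑ τ, (if momVec M σ + (Pi.single x 1 - Pi.single y 1) = momVec M τ then c σ * conj (c' τ) else 0) := by
  rw [Finset.sum_comm]
  simp only [dotProduct, mulVec, Pi.star_apply, Complex.star_def, Finset.mul_sum]
  refine sum_congr rfl fun τ _ => sum_congr rfl fun σ _ => ?_
  rw [siteRaise_mul_siteLower_apply M hxy]
  split_ifs <;> ring

/-- **The hopping integral**: `∫ e^{i(φ_x-φ_y)} P_c conj(P_c) = (2π)^{|Λ|} ⟨c, U_x U_yᵀ c⟩` for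
`x ≠ y`. [cite: WojtkiewiczPuszStachura2016, §3.1] -/
theorem integral_hopping_trigPoly {x y : Λ} (hxy : x ≠ y) (c : TensorIndex Λ (2 * M + 1) → ℂ) :
    ∫ φ in angleCell Λ, fourierFn (Pi.single x 1 - Pi.single y 1) φ * (trigPoly M c φ * conj (trigPoly M c φ)) =
      (((2 * Real.pi) ^ Fintype.card Λ : ℝ) : ℂ) * (star c ⬝ᵥ ((siteRaise M x * siteLower M y) *ᵥ c)) := by
  rw [integral_fourierFn_mul_trigPoly_mul_conj, star_dotProduct_hopping_mulVec M hxy]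

/-- `⟨c, U_xᵀ U_y c⟩ = conj ⟨c, U_x U_yᵀ c⟩` for `x ≠ y` (`U_xᵀ U_y = (U_x U_yᵀ)ᴴ`). [folklore] -/
theorem star_dotProduct_lower_raise_mulVec {x y : Λ} (hxy : x ≠ y) (c : TensorIndex Λ (2 * M + 1) → ℂ) :
    star c ⬝ᵥ ((siteLower M x * siteRaise M y) *ᵥ c) =
      conj (star c ⬝ᵥ ((siteRaise M x * siteLower M y) *ᵥ c)) := by
  have hH : (siteRaise M x * siteLower M y)ᴴ = siteLower M x * siteRaise M y := by
    rw [conjTranspose_mul, siteLower_conjTranspose, siteRaise_conjTranspose, siteRaise, siteLower,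
      onSite_mul_onSite_comm (Ne.symm hxy)]
  rw [← hH, mulVec_conjTranspose, star_dotProduct_star, ← dotProduct_mulVec, Complex.star_def]

/-- `Re ⟨c, U_x U_yᵀ c⟩ = Re ⟨c, (cos_x cos_y + sin_x sin_y) c⟩` (`truncBond = ½(U_xU_yᵀ + U_xᵀU_y)`).
[folklore] -/
theorem re_star_dotProduct_truncBond_mulVec {x y : Λ} (hxy : x ≠ y) (c : TensorIndex Λ (2 * M + 1) → ℂ) :
    (star c ⬝ᵥ (truncBond M x y *ᵥ c)).re = (star c ⬝ᵥ ((siteRaise M x * siteLower M y) *ᵥ c)).re := by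
  rw [truncBond_eq_half, smul_mulVec, dotProduct_smul, add_mulVec, dotProduct_add,
    star_dotProduct_lower_raise_mulVec M hxy, smul_eq_mul, Complex.mul_re]
  simp only [Complex.add_re, Complex.add_im, Complex.conj_re, Complex.conj_im]
  norm_num
  ring

end Hopping

/-! ### Normalised trigonometric polynomials as trial states -/

section Trial

variable [DecidableEq Λ] (M : ℕ)

/-- The normalisation `(2π)^{-|Λ|/2}` of the monomials on the cell. [folklore] -/
def cellNormConst (Λ : Type) [Fintype Λ] : ℝ := (Real.sqrt ((2 * Real.pi) ^ Fintype.card Λ))⁻¹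

omit [DecidableEq Λ] in
/-- `(2π)^{-|Λ|/2} · (2π)^{-|Λ|/2} · (2π)^{|Λ|} = 1`. [folklore] -/
theorem cellNormConst_sq_mul : cellNormConst Λ ^ 2 * (2 * Real.pi) ^ Fintype.card Λ = 1 := by
  have hpos : 0 < (2 * Real.pi) ^ Fintype.card Λ := by positivity
  rw [cellNormConst, inv_pow, Real.sq_sqrt hpos.le, inv_mul_cancel₀ hpos.ne']

omit [DecidableEq Λ] in
/-- `(2π)^{-|Λ|/2} > 0`. [folklore] -/
theorem cellNormConst_pos : 0 < cellNormConst Λ := by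
  unfold cellNormConst
  positivity

/-- `Σ_σ |c_σ|² = 1` for a unit coefficient vector (`⟨c, c⟩ = 1`). [folklore] -/
theorem sum_norm_sq_eq_one_of_unit {ι : Type*} [Fintype ι] {c : ι → ℂ} (hc : star c ⬝ᵥ c = 1) :
    ∑ i, ‖c i‖ ^ 2 = 1 := by
  have h : (star c ⬝ᵥ c) = ((∑ i, ‖c i‖ ^ 2 : ℝ) : ℂ) := by
    simp only [dotProduct, Pi.star_apply, Complex.star_def, Complex.ofReal_sum]
    refine sum_congr rfl fun i _ => ?_
    rw [mul_comm, Complex.mul_conj, Complex.normSq_eq_norm_sq]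
  rw [h] at hc
  exact_mod_cast hc

/-- **The normalised trigonometric polynomial of a unit coefficient vector is a trial state.**
[cite: KleinPerez1992, §2 (2.1) and §3] -/
def trialOf (c : TensorIndex Λ (2 * M + 1) → ℂ) (hc : star c ⬝ᵥ c = 1) : TrialState Λ where
  ψ φ := (cellNormConst Λ : ℂ) * trigPoly M c φ
  contDiff := contDiff_const.mul (contDiff_trigPoly M c)
  periodic φ x := by simp only [trigPoly_periodic]
  norm_eq := by
    have hint : IntegrableOn (fun φ => ‖(cellNormConst Λ : ℂ) * trigPoly M c φ‖ ^ 2) (angleCell Λ) := by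
      have hc' : Continuous fun φ => ‖(cellNormConst Λ : ℂ) * trigPoly M c φ‖ ^ 2 :=
        ((continuous_const.mul (continuous_trigPoly M c)).norm).pow 2
      exact (hc'.continuousOn.integrableOn_compact (isCompact_univ_pi fun _ : Λ => isCompact_Icc)).mono_set
        angleCell_subset_Icc
    have hval : ∫ φ in angleCell Λ, ‖(cellNormConst Λ : ℂ) * trigPoly M c φ‖ ^ 2 = 1 := by
      simp_rw [norm_mul, mul_pow, Complex.norm_real, Real.norm_of_nonneg cellNormConst_pos.le]
      rw [integral_const_mul, integral_norm_sq_trigPoly, sum_norm_sq_eq_one_of_unit hc, mul_one,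
        cellNormConst_sq_mul]
    have h1 := ofReal_integral_eq_lintegral_ofReal hint (ae_of_all _ fun φ => by positivity)
    rw [hval, ENNReal.ofReal_one] at h1
    rw [h1]
    refine lintegral_congr fun φ => ?_
    rw [← enorm_eq_nnnorm, ← ofReal_norm, ENNReal.ofReal_pow (norm_nonneg _)]

/-- The wave function of `trialOf`. [folklore] -/
theorem trialOf_ψ (c : TensorIndex Λ (2 * M + 1) → ℂ) (hc : star c ⬝ᵥ c = 1) (φ : Λ → ℝ) :
    (trialOf M c hc).ψ φ = (cellNormConst Λ : ℂ) * trigPoly M c φ := rfl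

/-- **The correlation of a trigonometric polynomial is the hopping matrix element**: for `x ≠ y`,
`cosCorrelation (trialOf c) x y = Re ⟨c, (cos_x cos_y + sin_x sin_y) c⟩`.
[cite: KleinPerez1992, §2 (2.3)] [cite: WojtkiewiczPuszStachura2016, §3.1] -/
theorem cosCorrelation_trialOf {x y : Λ} (hxy : x ≠ y) (c : TensorIndex Λ (2 * M + 1) → ℂ)
    (hc : star c ⬝ᵥ c = 1) :
    cosCorrelation (trialOf M c hc) x y = (star c ⬝ᵥ (truncBond M x y *ᵥ c)).re := by
  rw [re_star_dotProduct_truncBond_mulVec M hxy, cosCorrelation]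
  set d : Λ → ℤ := Pi.single x 1 - Pi.single y 1 with hd
  set Ψ := trialOf M c hc with hΨ
  have hphase : ∀ φ : Λ → ℝ, fourierFn d φ = Complex.exp (((φ x - φ y : ℝ) : ℂ) * I) := by
    intro φ
    rw [fourierFn]
    congr 3
    simp only [hd, Pi.sub_apply, Int.cast_sub, sub_mul, sum_sub_distrib, Pi.single_apply, Int.cast_ite,
      Int.cast_one, Int.cast_zero, ite_mul, one_mul, zero_mul, Finset.sum_ite_eq', Finset.mem_univ,
      if_true]
  -- the integrand is the real part of `e^{i(φ_x-φ_y)} ψ conj(ψ)`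
  have hpt : ∀ φ : Λ → ℝ, Real.cos (φ x - φ y) * ‖Ψ.ψ φ‖ ^ 2 =
      RCLike.re (fourierFn d φ * (Ψ.ψ φ * conj (Ψ.ψ φ))) := by
    intro φ
    rw [Complex.mul_conj, Complex.normSq_eq_norm_sq, hphase, RCLike.re_to_complex, mul_comm (Complex.exp _),
      Complex.re_ofReal_mul, Complex.exp_ofReal_mul_I_re, mul_comm]
  simp_rw [hpt]
  have hcont : Continuous Ψ.ψ := Ψ.contDiff.continuous
  have hint : Integrable (fun φ => fourierFn d φ * (Ψ.ψ φ * conj (Ψ.ψ φ))) (volume.restrict (angleCell Λ)) :=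
    integrableOn_angleCell_of_continuous ((continuous_fourierFn _).mul (hcont.mul hcont.star))
  rw [integral_re hint, RCLike.re_to_complex]
  have hψ2 : (fun φ => fourierFn d φ * (Ψ.ψ φ * conj (Ψ.ψ φ))) =
      fun φ => (cellNormConst Λ : ℂ) ^ 2 * (fourierFn d φ * (trigPoly M c φ * conj (trigPoly M c φ))) := by
    funext φ
    rw [hΨ, trialOf_ψ, map_mul, Complex.conj_ofReal]
    ring
  rw [hψ2, integral_const_mul, hd, integral_hopping_trigPoly M hxy, ← mul_assoc,
    show ((cellNormConst Λ : ℂ)) ^ 2 * (((2 * Real.pi) ^ Fintype.card Λ : ℝ) : ℂ) = 1 by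
      rw [← Complex.ofReal_pow, ← Complex.ofReal_mul, cellNormConst_sq_mul, Complex.ofReal_one], one_mul]

/-- For `x = y` the correlation is `1`, which dominates `Re ⟨c, (cos_x² + sin_x²) c⟩`
(`cos² + sin² ≤ 1` after truncation). [folklore] -/
theorem re_star_dotProduct_truncBond_self_le (x : Λ) (c : TensorIndex Λ (2 * M + 1) → ℂ)
    (hc : star c ⬝ᵥ c = 1) :
    (star c ⬝ᵥ (truncBond M x x *ᵥ c)).re ≤ cosCorrelation (trialOf M c hc) x x := by
  rw [cosCorrelation_self]
  have hpsd : ((1 : Op Λ (2 * M + 1)) - truncBond M x x).PosSemidef := by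
    simp only [truncBond]
    rw [siteCos_sq_add_siteSin_sq, sub_sub_cancel]
    exact ((posSemidef_onSite_truncTop M x).add (posSemidef_onSite_truncBot M x)).smul
      (by rw [show (1 / 2 : ℂ) = ((1 / 2 : ℝ) : ℂ) by norm_num]; exact Complex.zero_le_real.2 (by norm_num))
  have h := hpsd.dotProduct_mulVec_nonneg c
  rw [sub_mulVec, dotProduct_sub, one_mulVec, hc] at h
  have h' := (Complex.nonneg_iff.mp h).1
  rw [Complex.sub_re, Complex.one_re] at h'
  linarith

/-- **The correlation bound in both cases**: `Re ⟨c, (cos_x cos_y + sin_x sin_y) c⟩ ≤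
cosCorrelation (trialOf c) x y` for all `x, y` (equality for `x ≠ y`). [folklore] -/
theorem re_star_dotProduct_truncBond_le_cosCorrelation (x y : Λ) (c : TensorIndex Λ (2 * M + 1) → ℂ)
    (hc : star c ⬝ᵥ c = 1) :
    (star c ⬝ᵥ (truncBond M x y *ᵥ c)).re ≤ cosCorrelation (trialOf M c hc) x y := by
  by_cases hxy : x = y
  · subst hxy
    exact re_star_dotProduct_truncBond_self_le M x c hc
  · rw [cosCorrelation_trialOf M hxy]

/-! #### The energy form of a trigonometric polynomial is the Galerkin matrix -/

/-- `onSite x (diagonal f)` acts diagonally on coefficient vectors: `(N c)_σ = f(σ_x) c_σ`. [folklore] -/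
theorem onSite_diagonal_mulVec_apply {q : ℕ} (x : Λ) (f : Fin q → ℂ) (c : TensorIndex Λ q → ℂ)
    (σ : TensorIndex Λ q) : (onSite x (diagonal f) *ᵥ c) σ = f (σ x) * c σ := by
  rw [mulVec, dotProduct, Finset.sum_eq_single σ]
  · rw [onSite_apply, if_pos (fun y _ => rfl), diagonal_apply_eq]
  · intro τ _ hτ
    rw [onSite_apply]
    by_cases h : ∀ y, y ≠ x → σ y = τ y
    · rw [if_pos h, diagonal_apply_ne, zero_mul]
      intro hx
      apply hτ
      funext y
      by_cases hy : y = x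
      · subst hy; exact hx.symm
      · exact (h y hy).symm
    · rw [if_neg h, zero_mul]
  · exact fun h => absurd (Finset.mem_univ σ) h

/-- `Re ⟨c, N_x² c⟩ = Σ_σ n(σ)_x² |c_σ|²`. [folklore] -/
theorem re_star_dotProduct_siteMomentumSq_mulVec (x : Λ) (c : TensorIndex Λ (2 * M + 1) → ℂ) :
    (star c ⬝ᵥ (siteMomentumSq M x *ᵥ c)).re = ∑ σ, ((momVec M σ x : ℝ)) ^ 2 * ‖c σ‖ ^ 2 := by
  rw [siteMomentumSq, truncMomentum_mul_self, dotProduct, Complex.re_sum]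
  refine sum_congr rfl fun σ _ => ?_
  rw [onSite_diagonal_mulVec_apply, Pi.star_apply, Complex.star_def, momVec_apply,
    show conj (c σ) * ((((σ x : ℕ) : ℂ) - M) ^ 2 * c σ) =
      ((((((σ x : ℕ) : ℤ) - M : ℤ) : ℝ) ^ 2 : ℝ) : ℂ) * (c σ * conj (c σ)) by push_cast; ring,
    Complex.mul_conj, Complex.normSq_eq_norm_sq, ← Complex.ofReal_mul, Complex.ofReal_re]

/-- **The kinetic energy of a trigonometric polynomial**: `∫ |∂_x ψ|² = Re ⟨c, N_x² c⟩` for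
`ψ = (2π)^{-|Λ|/2} P_c`. [cite: KleinPerez1992, §2 (2.1)] -/
theorem integral_norm_sq_fderiv_trialOf (c : TensorIndex Λ (2 * M + 1) → ℂ) (hc : star c ⬝ᵥ c = 1) (x : Λ) :
    ∫ φ in angleCell Λ, ‖fderiv ℝ (trialOf M c hc).ψ φ (Pi.single x 1)‖ ^ 2 =
      (star c ⬝ᵥ (siteMomentumSq M x *ᵥ c)).re := by
  have hderiv : ∀ φ : Λ → ℝ, fderiv ℝ (trialOf M c hc).ψ φ (Pi.single x 1) =
      (cellNormConst Λ : ℂ) * trigPoly M (fun σ => I * (momVec M σ x : ℂ) * c σ) φ := by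
    intro φ
    have hψ : (trialOf M c hc).ψ = fun φ => (cellNormConst Λ : ℂ) * trigPoly M c φ := rfl
    rw [hψ, fderiv_const_mul ((contDiff_trigPoly M c (k := 1)).differentiable one_ne_zero φ),
      FunLike.coe_smul, Pi.smul_apply, fderiv_trigPoly_single, smul_eq_mul]
  simp_rw [hderiv, norm_mul, mul_pow, Complex.norm_real, Real.norm_of_nonneg cellNormConst_pos.le]
  rw [integral_const_mul, integral_norm_sq_trigPoly, ← mul_assoc, cellNormConst_sq_mul, one_mul,
    re_star_dotProduct_siteMomentumSq_mulVec]
  refine sum_congr rfl fun σ _ => ?_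
  rw [norm_mul, norm_mul, Complex.norm_I, one_mul, mul_pow, Complex.norm_intCast, sq_abs]

/-- **The potential energy of a trigonometric polynomial**: `∫ (1 - cos(φ_x-φ_y)) |ψ|² =
1 - Re ⟨c, (cos_x cos_y + sin_x sin_y) c⟩` for `x ≠ y`. [cite: KleinPerez1992, §2 (2.1), (2.3)] -/
theorem integral_one_sub_cos_mul_norm_sq_trialOf {x y : Λ} (hxy : x ≠ y)
    (c : TensorIndex Λ (2 * M + 1) → ℂ) (hc : star c ⬝ᵥ c = 1) :
    ∫ φ in angleCell Λ, (1 - Real.cos (φ x - φ y)) * ‖(trialOf M c hc).ψ φ‖ ^ 2 =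
      1 - (star c ⬝ᵥ (truncBond M x y *ᵥ c)).re := by
  have hcont : Continuous fun φ : Λ → ℝ => ‖(trialOf M c hc).ψ φ‖ ^ 2 :=
    ((trialOf M c hc).contDiff.continuous.norm).pow 2
  have hint1 : IntegrableOn (fun φ : Λ → ℝ => ‖(trialOf M c hc).ψ φ‖ ^ 2) (angleCell Λ) :=
    (hcont.continuousOn.integrableOn_compact (isCompact_univ_pi fun _ : Λ => isCompact_Icc)).mono_set
      angleCell_subset_Icc
  have hint2 : IntegrableOn (fun φ : Λ → ℝ => Real.cos (φ x - φ y) * ‖(trialOf M c hc).ψ φ‖ ^ 2)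
      (angleCell Λ) :=
    (((Real.continuous_cos.comp ((continuous_apply x).sub (continuous_apply y))).mul
      hcont).continuousOn.integrableOn_compact (isCompact_univ_pi fun _ : Λ => isCompact_Icc)).mono_set
      angleCell_subset_Icc
  simp_rw [sub_mul, one_mul]
  rw [integral_sub hint1 hint2, integral_norm_sq_eq_one, ← cosCorrelation_trialOf M hxy c hc, cosCorrelation]

/-- The energy integrand of `QuantumRotor.energy`, as a real function, for a trial state. [folklore] -/
theorem energy_eq_lintegral_ofReal {h J : ℝ} (hh : 0 ≤ h) (hJ : 0 ≤ J) (nn : Λ → Λ → Prop)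
    [DecidableRel nn] (Ψ : TrialState Λ) :
    energy h J nn Ψ = ∫⁻ φ in angleCell Λ, ENNReal.ofReal
      (h / 2 * ∑ x, ‖fderiv ℝ Ψ.ψ φ (Pi.single x 1)‖ ^ 2 +
        (J / 2 * ∑ x, ∑ y ∈ univ.filter (nn x), (1 - Real.cos (φ x - φ y))) * ‖Ψ.ψ φ‖ ^ 2) := by
  rw [energy]
  refine lintegral_congr fun φ => ?_
  have hV : 0 ≤ J / 2 * ∑ x, ∑ y ∈ univ.filter (nn x), (1 - Real.cos (φ x - φ y)) := by
    refine mul_nonneg (by positivity) (sum_nonneg fun x _ => sum_nonneg fun y _ => ?_)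
    linarith [Real.cos_le_one (φ x - φ y)]
  have hn : ∀ z : ℂ, ((‖z‖₊ : ℝ≥0∞)) ^ 2 = ENNReal.ofReal (‖z‖ ^ 2) := fun z => by
    rw [← enorm_eq_nnnorm, ← ofReal_norm, ENNReal.ofReal_pow (norm_nonneg _)]
  simp_rw [hn]
  rw [← ENNReal.ofReal_sum_of_nonneg (fun x _ => by positivity), ← ENNReal.ofReal_mul (by positivity),
    ← ENNReal.ofReal_mul hV, ← ENNReal.ofReal_add (by positivity) (by positivity)]

/-- **The energy form of a trigonometric polynomial is the Galerkin matrix**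
(`truncHamiltonian`, shifted by the constant that makes the form non-negative): for `h, J ≥ 0` and
an irreflexive neighbour relation,
`energy h J nn (trialOf c) = Re ⟨c, H_M c⟩ + (J/2) Σ_x #{y ∼ x}`.
[cite: KleinPerez1992, §2 (2.1)] [cite: WojtkiewiczPuszStachura2016, §3.1 (HamRot)] -/
theorem energy_trialOf {h J : ℝ} (hh : 0 ≤ h) (hJ : 0 ≤ J) (nn : Λ → Λ → Prop) [DecidableRel nn]
    (hnn : ∀ x, ¬ nn x x) (c : TensorIndex Λ (2 * M + 1) → ℂ) (hc : star c ⬝ᵥ c = 1) :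
    energy h J nn (trialOf M c hc) = ENNReal.ofReal
      ((star c ⬝ᵥ (truncHamiltonian M nn h J *ᵥ c)).re + J / 2 * ∑ x, ((univ.filter (nn x)).card : ℝ)) := by
  set Ψ := trialOf M c hc with hΨ
  -- the real integrand and its integrability
  set F : (Λ → ℝ) → ℝ := fun φ => h / 2 * ∑ x, ‖fderiv ℝ Ψ.ψ φ (Pi.single x 1)‖ ^ 2 +
    (J / 2 * ∑ x, ∑ y ∈ univ.filter (nn x), (1 - Real.cos (φ x - φ y))) * ‖Ψ.ψ φ‖ ^ 2 with hF
  have hψc : Continuous Ψ.ψ := Ψ.contDiff.continuous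
  have hdc : ∀ x, Continuous fun φ => fderiv ℝ Ψ.ψ φ (Pi.single x 1) := fun x =>
    (Ψ.contDiff.continuous_fderiv one_ne_zero).clm_apply continuous_const
  have hK : IsCompact (Set.univ.pi fun _ : Λ => Set.Icc (-Real.pi) Real.pi) :=
    isCompact_univ_pi fun _ => isCompact_Icc
  have hVc : Continuous fun φ : Λ → ℝ => J / 2 * ∑ x, ∑ y ∈ univ.filter (nn x), (1 - Real.cos (φ x - φ y)) :=
    continuous_const.mul (continuous_finsetSum _ fun x _ => continuous_finsetSum _ fun y _ =>
      continuous_const.sub (Real.continuous_cos.comp ((continuous_apply x).sub (continuous_apply y))))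
  have hkin_c : ∀ x, Continuous fun φ => ‖fderiv ℝ Ψ.ψ φ (Pi.single x 1)‖ ^ 2 := fun x =>
    ((hdc x).norm).pow 2
  have hFc : Continuous F := (continuous_const.mul (continuous_finsetSum _ fun x _ => hkin_c x)).add
    (hVc.mul ((hψc.norm).pow 2))
  have hF0 : ∀ φ, 0 ≤ F φ := by
    intro φ
    have hV : 0 ≤ J / 2 * ∑ x, ∑ y ∈ univ.filter (nn x), (1 - Real.cos (φ x - φ y)) := by
      refine mul_nonneg (by positivity) (sum_nonneg fun x _ => sum_nonneg fun y _ => ?_)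
      linarith [Real.cos_le_one (φ x - φ y)]
    positivity
  have hFi : IntegrableOn F (angleCell Λ) := (hFc.continuousOn.integrableOn_compact hK).mono_set angleCell_subset_Icc
  rw [energy_eq_lintegral_ofReal hh hJ, ← ofReal_integral_eq_lintegral_ofReal hFi (ae_of_all _ hF0)]
  congr 1
  -- compute `∫ F`
  have hkin_i : ∀ x, IntegrableOn (fun φ => ‖fderiv ℝ Ψ.ψ φ (Pi.single x 1)‖ ^ 2) (angleCell Λ) :=
    fun x => ((hkin_c x).continuousOn.integrableOn_compact hK).mono_set angleCell_subset_Icc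
  have hpot_i : ∀ x y, IntegrableOn (fun φ : Λ → ℝ => (1 - Real.cos (φ x - φ y)) * ‖Ψ.ψ φ‖ ^ 2)
      (angleCell Λ) := fun x y =>
    (((continuous_const.sub (Real.continuous_cos.comp ((continuous_apply x).sub (continuous_apply y)))).mul
      ((hψc.norm).pow 2)).continuousOn.integrableOn_compact hK).mono_set angleCell_subset_Icc
  have h1 : ∫ φ in angleCell Λ, F φ =
      h / 2 * ∑ x, (∫ φ in angleCell Λ, ‖fderiv ℝ Ψ.ψ φ (Pi.single x 1)‖ ^ 2) +
        J / 2 * ∑ x, ∑ y ∈ univ.filter (nn x),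
          (∫ φ in angleCell Λ, (1 - Real.cos (φ x - φ y)) * ‖Ψ.ψ φ‖ ^ 2) := by
    have e1 : ∀ φ, F φ = h / 2 * ∑ x, ‖fderiv ℝ Ψ.ψ φ (Pi.single x 1)‖ ^ 2 +
        J / 2 * ∑ x, ∑ y ∈ univ.filter (nn x), (1 - Real.cos (φ x - φ y)) * ‖Ψ.ψ φ‖ ^ 2 := by
      intro φ
      simp only [hF, mul_assoc, sum_mul]
    simp_rw [e1]
    rw [integral_add, integral_const_mul, integral_const_mul, integral_finsetSum _ (fun x _ => hkin_i x),
      integral_finsetSum _ (fun x _ => integrable_finsetSum _ fun y _ => hpot_i x y)]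
    · congr 1
      congr 1
      exact sum_congr rfl fun x _ => integral_finsetSum _ fun y _ => hpot_i x y
    · exact (integrable_finsetSum _ fun x _ => hkin_i x).const_mul _
    · exact (integrable_finsetSum _ fun x _ => integrable_finsetSum _ fun y _ => hpot_i x y).const_mul _
  rw [h1]
  simp_rw [hΨ, integral_norm_sq_fderiv_trialOf]
  have hne : ∀ x y, y ∈ univ.filter (nn x) → x ≠ y := by
    intro x y hy h'
    subst h'
    exact hnn x (mem_filter.1 hy).2
  rw [sum_congr rfl fun x _ => sum_congr rfl fun y hy =>
    integral_one_sub_cos_mul_norm_sq_trialOf M (hne x y hy) c hc]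
  -- the matrix side
  rw [truncHamiltonian, sub_mulVec, dotProduct_sub, Matrix.sum_mulVec, dotProduct_sum, Matrix.sum_mulVec,
    dotProduct_sum, Complex.sub_re, Complex.re_sum, Complex.re_sum]
  simp_rw [Matrix.sum_mulVec, dotProduct_sum, Complex.re_sum, smul_mulVec, dotProduct_smul, smul_eq_mul,
    Complex.re_ofReal_mul, sum_sub_distrib, sum_const, nsmul_eq_mul, mul_one, ← mul_sum]
  ring

end Trial

/-! ### Zero-padding of coefficient vectors: nested Galerkin spaces -/

section Pad

variable [DecidableEq Λ] {M M' : ℕ}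

/-- The momentum-preserving inclusion `{-M,…,M} ↪ {-M',…,M'}` of index sets (`M ≤ M'`). [folklore] -/
def padIdx (hMM : M ≤ M') (a : Fin (2 * M + 1)) : Fin (2 * M' + 1) := ⟨a.val + (M' - M), by omega⟩

omit [Fintype Λ] [DecidableEq Λ] in
/-- `padIdx` is injective. [folklore] -/
theorem padIdx_injective (hMM : M ≤ M') : Function.Injective (padIdx hMM) := by
  intro a b h
  have := congrArg Fin.val h
  simp only [padIdx] at this
  exact Fin.ext (by omega)

/-- The inclusion of tensor indices `σ ↦ padIdx ∘ σ`. [folklore] -/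
def padTensorIndex (hMM : M ≤ M') (σ : TensorIndex Λ (2 * M + 1)) : TensorIndex Λ (2 * M' + 1) :=
  fun x => padIdx hMM (σ x)

omit [Fintype Λ] [DecidableEq Λ] in
/-- `padTensorIndex` is injective. [folklore] -/
theorem padTensorIndex_injective (hMM : M ≤ M') : Function.Injective (padTensorIndex (Λ := Λ) hMM) :=
  fun _ _ h => funext fun x => padIdx_injective hMM (congrFun h x)

omit [Fintype Λ] [DecidableEq Λ] in
/-- Padding preserves the frequencies: `n'(pad σ) = n(σ)`. [folklore] -/
theorem momVec_padTensorIndex (hMM : M ≤ M') (σ : TensorIndex Λ (2 * M + 1)) :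
    momVec M' (padTensorIndex hMM σ) = momVec M σ := by
  funext x
  simp only [momVec_apply, padTensorIndex, padIdx]
  push_cast
  omega

/-- **Zero-padding** of a coefficient vector from degree `M` to degree `M' ≥ M`. [folklore] -/
def padCoeff (hMM : M ≤ M') (c : TensorIndex Λ (2 * M + 1) → ℂ) : TensorIndex Λ (2 * M' + 1) → ℂ :=
  Function.extend (padTensorIndex hMM) c 0

omit [Fintype Λ] [DecidableEq Λ] in
/-- On the image, the padded vector is the original one. [folklore] -/
theorem padCoeff_apply_pad (hMM : M ≤ M') (c : TensorIndex Λ (2 * M + 1) → ℂ) (σ : TensorIndex Λ (2 * M + 1)) :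
    padCoeff hMM c (padTensorIndex hMM σ) = c σ :=
  (padTensorIndex_injective hMM).extend_apply _ _ _

omit [Fintype Λ] [DecidableEq Λ] in
/-- Off the image, the padded vector vanishes. [folklore] -/
theorem padCoeff_apply_of_not_mem (hMM : M ≤ M') (c : TensorIndex Λ (2 * M + 1) → ℂ)
    {σ' : TensorIndex Λ (2 * M' + 1)} (h : ¬ ∃ σ, padTensorIndex hMM σ = σ') : padCoeff hMM c σ' = 0 := by
  rw [padCoeff, Function.extend_apply' _ _ _ h, Pi.zero_apply]

/-- Sums of functions vanishing off the image of the padding are sums over the smaller index set.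
[folklore] -/
theorem sum_eq_sum_pad (hMM : M ≤ M') (f : TensorIndex Λ (2 * M' + 1) → ℂ)
    (hf : ∀ σ', (¬ ∃ σ, padTensorIndex hMM σ = σ') → f σ' = 0) :
    ∑ σ', f σ' = ∑ σ, f (padTensorIndex hMM σ) := by
  rw [← Finset.sum_image (fun _ _ _ _ h => padTensorIndex_injective hMM h)]
  symm
  refine Finset.sum_subset (Finset.subset_univ _) fun σ' _ hσ' => hf σ' ?_
  rintro ⟨σ, rfl⟩
  exact hσ' (Finset.mem_image_of_mem _ (Finset.mem_univ σ))

/-- **Padding does not change the trigonometric polynomial.** [folklore] -/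
theorem trigPoly_padCoeff (hMM : M ≤ M') (c : TensorIndex Λ (2 * M + 1) → ℂ) :
    trigPoly M' (padCoeff hMM c) = trigPoly M c := by
  funext φ
  rw [trigPoly, trigPoly, sum_eq_sum_pad hMM _ (fun σ' hσ' => by
    rw [padCoeff_apply_of_not_mem hMM c hσ', zero_mul])]
  refine sum_congr rfl fun σ _ => ?_
  rw [padCoeff_apply_pad, momVec_padTensorIndex]

/-- Padding preserves the norm: `⟨pad c, pad c⟩ = ⟨c, c⟩`. [folklore] -/
theorem star_padCoeff_dotProduct (hMM : M ≤ M') (c : TensorIndex Λ (2 * M + 1) → ℂ) :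
    star (padCoeff hMM c) ⬝ᵥ padCoeff hMM c = star c ⬝ᵥ c := by
  rw [dotProduct, dotProduct, sum_eq_sum_pad hMM _ (fun σ' hσ' => by
    rw [Pi.star_apply, padCoeff_apply_of_not_mem hMM c hσ', mul_zero])]
  refine sum_congr rfl fun σ _ => ?_
  rw [Pi.star_apply, Pi.star_apply, padCoeff_apply_pad]

/-- The trial state of the padded vector is the same wave function. [folklore] -/
theorem trialOf_padCoeff_ψ (hMM : M ≤ M') (c : TensorIndex Λ (2 * M + 1) → ℂ) (hc : star c ⬝ᵥ c = 1)
    (hc' : star (padCoeff hMM c) ⬝ᵥ padCoeff hMM c = 1) :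
    (trialOf M' (padCoeff hMM c) hc').ψ = (trialOf M c hc).ψ := by
  funext φ
  rw [trialOf_ψ, trialOf_ψ, trigPoly_padCoeff]

/-- The energy of a trial state depends only on its wave function. [folklore] -/
theorem energy_congr_ψ (h J : ℝ) (nn : Λ → Λ → Prop) [DecidableRel nn] {Ψ₁ Ψ₂ : TrialState Λ}
    (hψ : Ψ₁.ψ = Ψ₂.ψ) : energy h J nn Ψ₁ = energy h J nn Ψ₂ := by
  simp only [energy, hψ]

/-- The correlation of a trial state depends only on its wave function. [folklore] -/
theorem cosCorrelation_congr_ψ {Ψ₁ Ψ₂ : TrialState Λ} (hψ : Ψ₁.ψ = Ψ₂.ψ) (x y : Λ) :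
    cosCorrelation Ψ₁ x y = cosCorrelation Ψ₂ x y := by
  simp only [cosCorrelation, hψ]

/-- **The shifted Galerkin energy is non-negative**: `0 ≤ Re ⟨c, H_M c⟩ + (J/2) Σ_x #{y ∼ x}` for a
unit vector (`N_x² ≥ 0` and `Re ⟨c, B c⟩ ≤ 1` on every bond). [folklore] -/
theorem re_galerkinEnergy_nonneg {h J : ℝ} (hh : 0 ≤ h) (hJ : 0 ≤ J) (nn : Λ → Λ → Prop) [DecidableRel nn]
    (hnn : ∀ x, ¬ nn x x) (c : TensorIndex Λ (2 * M + 1) → ℂ) (hc : star c ⬝ᵥ c = 1) :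
    0 ≤ (star c ⬝ᵥ (truncHamiltonian M nn h J *ᵥ c)).re + J / 2 * ∑ x, ((univ.filter (nn x)).card : ℝ) := by
  have hkin : ∀ x, 0 ≤ (star c ⬝ᵥ (siteMomentumSq M x *ᵥ c)).re := by
    intro x
    rw [re_star_dotProduct_siteMomentumSq_mulVec]
    exact sum_nonneg fun σ _ => by positivity
  have hbond : ∀ x y, y ∈ univ.filter (nn x) → (star c ⬝ᵥ (truncBond M x y *ᵥ c)).re ≤ 1 := by
    intro x y hy
    have hxy : x ≠ y := by intro h'; subst h'; exact hnn x (mem_filter.1 hy).2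
    have hpsd := (posSemidef_one_sub_truncBond M hxy).dotProduct_mulVec_nonneg c
    rw [sub_mulVec, dotProduct_sub, one_mulVec, hc] at hpsd
    have h' := (Complex.nonneg_iff.mp hpsd).1
    rw [Complex.sub_re, Complex.one_re] at h'
    linarith
  have hexp : (star c ⬝ᵥ (truncHamiltonian M nn h J *ᵥ c)).re =
      h / 2 * ∑ x, (star c ⬝ᵥ (siteMomentumSq M x *ᵥ c)).re -
        J / 2 * ∑ x, ∑ y ∈ univ.filter (nn x), (star c ⬝ᵥ (truncBond M x y *ᵥ c)).re := by
    rw [truncHamiltonian, sub_mulVec, dotProduct_sub, Matrix.sum_mulVec, dotProduct_sum, Matrix.sum_mulVec,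
      dotProduct_sum, Complex.sub_re, Complex.re_sum, Complex.re_sum, mul_sum, mul_sum]
    congr 1
    · refine sum_congr rfl fun x _ => ?_
      rw [smul_mulVec, dotProduct_smul, smul_eq_mul, Complex.re_ofReal_mul]
    · refine sum_congr rfl fun x _ => ?_
      rw [Matrix.sum_mulVec, dotProduct_sum, Complex.re_sum, mul_sum]
      refine sum_congr rfl fun y _ => ?_
      rw [smul_mulVec, dotProduct_smul, smul_eq_mul, Complex.re_ofReal_mul]
  have hsum1 : ∑ x, ∑ y ∈ univ.filter (nn x), (star c ⬝ᵥ (truncBond M x y *ᵥ c)).re ≤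
      ∑ x, ((univ.filter (nn x)).card : ℝ) := by
    refine sum_le_sum fun x _ => ?_
    calc ∑ y ∈ univ.filter (nn x), (star c ⬝ᵥ (truncBond M x y *ᵥ c)).re
        ≤ ∑ y ∈ univ.filter (nn x), (1 : ℝ) := sum_le_sum fun y hy => hbond x y hy
      _ = ((univ.filter (nn x)).card : ℝ) := by simp
  have hsum0 : 0 ≤ ∑ x, (star c ⬝ᵥ (siteMomentumSq M x *ᵥ c)).re := sum_nonneg fun x _ => hkin x
  rw [hexp]
  have hJ2 : 0 ≤ J / 2 := by positivity
  have hh2 : 0 ≤ h / 2 := by positivity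
  nlinarith [mul_le_mul_of_nonneg_left hsum1 hJ2, mul_nonneg hh2 hsum0]

/-- **Nested Galerkin energies**: the Galerkin energy of a unit vector of degree `M` is attained by a
unit vector of every degree `M' ≥ M` (its padding). [folklore] -/
theorem re_star_dotProduct_truncHamiltonian_padCoeff {h J : ℝ} (hh : 0 ≤ h) (hJ : 0 ≤ J)
    (nn : Λ → Λ → Prop) [DecidableRel nn] (hnn : ∀ x, ¬ nn x x) (hMM : M ≤ M')
    (c : TensorIndex Λ (2 * M + 1) → ℂ) (hc : star c ⬝ᵥ c = 1) :
    (star (padCoeff hMM c) ⬝ᵥ (truncHamiltonian M' nn h J *ᵥ padCoeff hMM c)).re =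
      (star c ⬝ᵥ (truncHamiltonian M nn h J *ᵥ c)).re := by
  have hc' : star (padCoeff hMM c) ⬝ᵥ padCoeff hMM c = 1 := by rw [star_padCoeff_dotProduct, hc]
  have h1 := energy_trialOf (M := M') hh hJ nn hnn (padCoeff hMM c) hc'
  have h2 := energy_trialOf (M := M) hh hJ nn hnn c hc
  have h3 : energy h J nn (trialOf M' (padCoeff hMM c) hc') = energy h J nn (trialOf M c hc) :=
    energy_congr_ψ h J nn (trialOf_padCoeff_ψ hMM c hc hc')
  rw [h1, h2] at h3
  have e := (ENNReal.ofReal_eq_ofReal_iff (re_galerkinEnergy_nonneg hh hJ nn hnn _ hc')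
    (re_galerkinEnergy_nonneg hh hJ nn hnn _ hc)).1 h3
  linarith

end Pad

end QuantumRotor

end Literature.MathematicalPhysics.QuantumLattice
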